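import Mathlib
import HarnessLib
import Summits.RiemannHypothesis.RiemannHypothesis.Theses.WeilParity
import Summits.RiemannHypothesis.RiemannHypothesis.Theses.GroundBarta
import Summits.RiemannHypothesis.RiemannHypothesis.Theorems.WeilParityEvenWinsBeyondArchSplit
import Summits.RiemannHypothesis.RiemannHypothesis.Theorems.WeilParityOnePrimeWindowSimpleEven
import Summits.RiemannHypothesis.RiemannHypothesis.Theorems.WeilParityEvenWinsArch
import Summits.RiemannHypothesis.RiemannHypothesis.Theorems.WeilGroundStateGroundStateSimpleEvenTwoPrimeWindows

/-!
# Crux `EvenWinsBeyondArch` (stmt-RiemannHypothesis-15432; GroundBarta copy stmt-RiemannHypothesis-18807):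
# the RH-free frontier at the window `63/100`, and the residual input stated once

Support file (`--supports stmt-RiemannHypothesis-15432`).  The two-prime cells E = `[549/1000, 59/100]`,
F = `[59/100, 63/100]` of the sister crux `GroundStateSimpleEven` (stmt-RiemannHypothesis-1526, line
`parity-multiplicity-commutator` v7) are landed and composed
(`Theorems/WeilGroundStateGroundStateSimpleEvenTwoPrimeWindows.lean`): the strict parity order
`ε_ev(a) < ε_od(a)` is certified, RH-free, on EVERY window `0 < a ≤ 63/100`
(`Theorems.weilEvenGroundEnergy_lt_weilOddGroundEnergy_of_le_63_100`), and the route residue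
`NoParityCrossing` (stmt-RiemannHypothesis-18085) is equivalent to "no parity tie beyond `63/100`"
(`Theorems.noParityCrossing_iff_beyond_63_100`).  This file records the consequences for THIS crux:

1. `WeilParity.evenSectorWins_upTo_63`: the route thesis (every odd normalised Weil test is matched up to
   any `δ > 0` by an even one) on EVERY window `0 < a ≤ 63/100` — the proved part of the crux, extending
   `evenSectorWins_upTo_logThreeHalf`;
2. `evenWinsBeyondArch_of_noTie_beyond_63`: the crux follows from `∀ a > 63/100, ε_ev(a) ≠ ε_od(a)` —
   VERBATIM the single open stub `stub_noParityCrossing_beyondF` of the sister skeleton v7 — through the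
   landed split glue (`evenWinsBeyondArch_of_subs` with `onePrimeWindowSimpleEven_proof`), so the open
   items 1526 / 18085 / 15432 / 18807 hinge on ONE residual statement;
3. `evenWinsBeyondArch_iff_forall_le_beyond_63`: what the crux still asserts beyond the certified range is
   exactly `∀ a > 63/100, ε_ev(a) ≤ ε_od(a)`;
4. the GroundBarta copy (rev 1, cone-free text) is the same proposition (`Iff.rfl`), so 2–3 transport.

Mathlib + landed tree files only; no definitions, no named facts, no `sorry`.
-/

noncomputable section

open Set MeasureTheory

-- D-0017: single-problem summit ⇒ namespace `Summit.RiemannHypothesis.RiemannHypothesis.…` by design.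
set_option linter.dupNamespace false

namespace Summit.RiemannHypothesis.RiemannHypothesis.Theorems.EvenWinsBeyondArch

open Literature.NumberTheory.LFunctions
open Summit.RiemannHypothesis.RiemannHypothesis.Theses.WeilParity

/-- `(log 2)/2 < 63/100` (`Real.log_two_lt_d9`). [folklore] -/
theorem log_two_half_lt_63 : Real.log 2 / 2 < (63 / 100 : ℝ) := by
  have h := Real.log_two_lt_d9
  linarith

/-! ## The residual input stated once: no parity tie beyond `63/100` -/

/-- **Strict order beyond the arch from "no tie beyond `63/100`"**: if `ε_ev(a) ≠ ε_od(a)` for every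
`a > 63/100` (the open stub `stub_noParityCrossing_beyondF` of crux 1526, v7), then `ε_ev(a) < ε_od(a)` for
EVERY `a > (log 2)/2` (the landed split glue: one-prime windows certified, `NoParityCrossing` from the
residue by `Theorems.noParityCrossing_of_beyond_63_100`, IVT propagation with landed sector continuity). [folklore] -/
theorem weilEvenGroundEnergy_lt_weilOddGroundEnergy_of_noTie_beyond_63
    (hne : ∀ a : ℝ, 63 / 100 < a → weilEvenGroundEnergy a ≠ weilOddGroundEnergy a)
    {a : ℝ} (ha : Real.log 2 / 2 < a) : weilEvenGroundEnergy a < weilOddGroundEnergy a :=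
  weilEvenGroundEnergy_lt_weilOddGroundEnergy_of_subs WeilParity.onePrimeWindowSimpleEven_proof
    (Summit.RiemannHypothesis.RiemannHypothesis.Theorems.noParityCrossing_of_beyond_63_100 hne) ha

/-- **The crux from "no tie beyond `63/100`"**: `(∀ a > 63/100, ε_ev(a) ≠ ε_od(a)) → EvenWinsBeyondArch`.
The hypothesis is verbatim the single open stub of the sister skeleton (crux 1526, v7) and is equivalent
to item stmt-RiemannHypothesis-18085 (`Theorems.noParityCrossing_iff_beyond_63_100`). [folklore] -/
theorem evenWinsBeyondArch_of_noTie_beyond_63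
    (hne : ∀ a : ℝ, 63 / 100 < a → weilEvenGroundEnergy a ≠ weilOddGroundEnergy a) :
    EvenWinsBeyondArch :=
  evenWinsBeyondArch_of_subs WeilParity.onePrimeWindowSimpleEven_proof
    (Summit.RiemannHypothesis.RiemannHypothesis.Theorems.noParityCrossing_of_beyond_63_100 hne)

/-- **What the crux still asserts**: `EvenWinsBeyondArch ↔ ∀ a > 63/100, ε_ev(a) ≤ ε_od(a)` — up to
`63/100` the order is certified (strictly, `Theorems.weilEvenGroundEnergy_lt_weilOddGroundEnergy_of_le_63_100`),
so only the windows beyond `63/100` carry content. [folklore] -/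
theorem evenWinsBeyondArch_iff_forall_le_beyond_63 :
    EvenWinsBeyondArch ↔ ∀ a : ℝ, 63 / 100 < a → weilEvenGroundEnergy a ≤ weilOddGroundEnergy a := by
  rw [evenWinsBeyondArch_iff_forall_le]
  refine ⟨fun h a ha ↦ h a (log_two_half_lt_63.trans ha), fun h a ha ↦ ?_⟩
  rcases le_or_gt a (63 / 100) with hle | hlt
  · exact (Summit.RiemannHypothesis.RiemannHypothesis.Theorems.weilEvenGroundEnergy_lt_weilOddGroundEnergy_of_le_63_100
      (log_two_half_pos.trans ha) hle).le
  · exact h a hlt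

/-- **No tie ⟺ order, beyond `63/100`, given the crux direction**: the residual hypothesis of
`evenWinsBeyondArch_of_noTie_beyond_63` is itself implied by the strict order, so the crux is squeezed between
`∀ a > 63/100, ε_ev < ε_od` and `∀ a > 63/100, ε_ev ≤ ε_od`. [folklore] -/
theorem evenWinsBeyondArch_of_forall_lt_beyond_63
    (hlt : ∀ a : ℝ, 63 / 100 < a → weilEvenGroundEnergy a < weilOddGroundEnergy a) :
    EvenWinsBeyondArch :=
  evenWinsBeyondArch_of_noTie_beyond_63 fun a ha ↦ (hlt a ha).ne

/-! ## Where a counterexample would have to live -/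

/-- **A failure of the crux is a strict reversal `ε_od(a) < ε_ev(a)` at some window `a > 63/100`** — the
certified range is excluded (sharpens `Negative.not_evenWinsBeyondArch_iff`, whose window was only `> (log 2)/2`).
[folklore] -/
theorem not_evenWinsBeyondArch_iff_beyond_63 :
    ¬ EvenWinsBeyondArch ↔ ∃ a : ℝ, 63 / 100 < a ∧ weilOddGroundEnergy a < weilEvenGroundEnergy a := by
  rw [evenWinsBeyondArch_iff_forall_le_beyond_63]
  push Not
  rfl

/-- **A failure of the crux forces an exact parity tie `ε_ev(a) = ε_od(a)` at some window `a > 63/100`**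
(contrapositive of `evenWinsBeyondArch_of_noTie_beyond_63`). [folklore] -/
theorem exists_tie_beyond_63_of_not_evenWinsBeyondArch (h : ¬ EvenWinsBeyondArch) :
    ∃ a : ℝ, 63 / 100 < a ∧ weilEvenGroundEnergy a = weilOddGroundEnergy a := by
  by_contra hne
  push Not at hne
  exact h (evenWinsBeyondArch_of_noTie_beyond_63 hne)

end Summit.RiemannHypothesis.RiemannHypothesis.Theorems.EvenWinsBeyondArch

/-! ## The route thesis on every window up to `63/100` -/

namespace Summit.RiemannHypothesis.RiemannHypothesis.Theorems.WeilParity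

open Literature.NumberTheory.LFunctions

/-- **Ground-energy form of the frontier**: `ε_ev(a) ≤ ε_od(a)` for every `0 < a ≤ 63/100` (in fact strict,
`Theorems.weilEvenGroundEnergy_lt_weilOddGroundEnergy_of_le_63_100`). RH-free. [folklore] -/
theorem weilEvenGroundEnergy_le_weilOddGroundEnergy_of_le_63 {a : ℝ} (ha : 0 < a) (hle : a ≤ 63 / 100) :
    weilEvenGroundEnergy a ≤ weilOddGroundEnergy a :=
  (Summit.RiemannHypothesis.RiemannHypothesis.Theorems.weilEvenGroundEnergy_lt_weilOddGroundEnergy_of_le_63_100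
    ha hle).le

/-- **The even sector wins on every window `0 < a ≤ 63/100`** (the route thesis `EvenSectorWins`
restricted to the certified windows: archimedean, one-prime, and the two-prime cells E, F): every odd
`L²`-normalised Weil test on `[-a, a]` is matched up to any `δ > 0` by an even one. RH-free; extends
`evenSectorWins_upTo_logThreeHalf` (ORDER ⇒ MATCHING, `evenWinsAt_of_le`). [folklore] -/
theorem evenSectorWins_upTo_63 :
    ∀ a : ℝ, 0 < a → a ≤ 63 / 100 → ∀ o : ℝ → ℂ,
      Literature.NumberTheory.LFunctions.IsWeilTest o → tsupport o ⊆ Set.Icc (-a) a →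
      (∀ t, o (-t) = -o t) → ∫ t, ‖o t‖ ^ 2 = (1 : ℝ) → ∀ δ : ℝ, 0 < δ →
        ∃ e : ℝ → ℂ, Literature.NumberTheory.LFunctions.IsWeilTest e ∧ tsupport e ⊆ Set.Icc (-a) a ∧
          (∀ t, e (-t) = e t) ∧ ∫ t, ‖e t‖ ^ 2 = (1 : ℝ) ∧
          (Literature.NumberTheory.LFunctions.weilQuadratic e).re ≤
            (Literature.NumberTheory.LFunctions.weilQuadratic o).re + δ :=
  fun _ ha hle ↦ evenWinsAt_of_le ha (weilEvenGroundEnergy_le_weilOddGroundEnergy_of_le_63 ha hle)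

/-- **The crux restricted to the certified windows holds**: `EvenWinsBeyondArch` with the extra bound
`a ≤ 63/100`. RH-free. [folklore] -/
theorem evenWinsBeyondArch_upTo_63 :
    ∀ a : ℝ, Real.log 2 / 2 < a → a ≤ 63 / 100 → ∀ o : ℝ → ℂ,
      Literature.NumberTheory.LFunctions.IsWeilTest o → tsupport o ⊆ Set.Icc (-a) a →
      (∀ t, o (-t) = -o t) → ∫ t, ‖o t‖ ^ 2 = (1 : ℝ) → ∀ δ : ℝ, 0 < δ →
        ∃ e : ℝ → ℂ, Literature.NumberTheory.LFunctions.IsWeilTest e ∧ tsupport e ⊆ Set.Icc (-a) a ∧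
          (∀ t, e (-t) = e t) ∧ ∫ t, ‖e t‖ ^ 2 = (1 : ℝ) ∧
          (Literature.NumberTheory.LFunctions.weilQuadratic e).re ≤
            (Literature.NumberTheory.LFunctions.weilQuadratic o).re + δ :=
  fun a ha hle ↦ evenSectorWins_upTo_63 a (EvenWinsBeyondArch.log_two_half_pos.trans ha) hle

end Summit.RiemannHypothesis.RiemannHypothesis.Theorems.WeilParity

/-! ## Transport to the GroundBarta copy (stmt-RiemannHypothesis-18807) -/

namespace Summit.RiemannHypothesis.RiemannHypothesis.Theorems.GroundBarta

open Literature.NumberTheory.LFunctions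

/-- The cone-free GroundBarta text of the crux (rev 1) IS the WeilParity crux: the two `def`s unfold to the
same term (`Iff.rfl`). [folklore] -/
theorem evenWinsBeyondArch_iff_weilParity :
    Summit.RiemannHypothesis.RiemannHypothesis.Theses.GroundBarta.EvenWinsBeyondArch ↔
      Summit.RiemannHypothesis.RiemannHypothesis.Theses.WeilParity.EvenWinsBeyondArch :=
  Iff.rfl

/-- **GroundBarta's crux from "no tie beyond `63/100`"** (transport of
`EvenWinsBeyondArch.evenWinsBeyondArch_of_noTie_beyond_63`). [folklore] -/
theorem evenWinsBeyondArch_of_noTie_beyond_63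
    (hne : ∀ a : ℝ, 63 / 100 < a → weilEvenGroundEnergy a ≠ weilOddGroundEnergy a) :
    Summit.RiemannHypothesis.RiemannHypothesis.Theses.GroundBarta.EvenWinsBeyondArch :=
  evenWinsBeyondArch_iff_weilParity.2 (EvenWinsBeyondArch.evenWinsBeyondArch_of_noTie_beyond_63 hne)

/-- **GroundBarta's crux from the route residue `NoParityCrossing`** (stmt-RiemannHypothesis-18085),
transport of the landed split glue. [folklore] -/
theorem evenWinsBeyondArch_of_noParityCrossing
    (h : Summit.RiemannHypothesis.RiemannHypothesis.Theses.WeilParity.NoParityCrossing) :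
    Summit.RiemannHypothesis.RiemannHypothesis.Theses.GroundBarta.EvenWinsBeyondArch :=
  evenWinsBeyondArch_iff_weilParity.2
    (EvenWinsBeyondArch.evenWinsBeyondArch_of_subs WeilParity.onePrimeWindowSimpleEven_proof h)

/-- **What GroundBarta's crux still asserts**: `↔ ∀ a > 63/100, ε_ev(a) ≤ ε_od(a)`. [folklore] -/
theorem evenWinsBeyondArch_iff_forall_le_beyond_63 :
    Summit.RiemannHypothesis.RiemannHypothesis.Theses.GroundBarta.EvenWinsBeyondArch ↔
      ∀ a : ℝ, 63 / 100 < a → weilEvenGroundEnergy a ≤ weilOddGroundEnergy a :=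
  evenWinsBeyondArch_iff_weilParity.trans EvenWinsBeyondArch.evenWinsBeyondArch_iff_forall_le_beyond_63

end Summit.RiemannHypothesis.RiemannHypothesis.Theorems.GroundBarta

end
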